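import Literature.NumberTheory.Transcendental.CurvePeriodsEllipticCMIsogenyProofs
import Literature.NumberTheory.EllipticCurves.LatticeInclusionRationalProofs
import HarnessLib

/-!
# Periods of curve type on elliptic curves, XIV: isogenies as functoriality

Companion of `Literature/NumberTheory/Transcendental/CurvePeriods.lean` (Huber–Wüstholz 2022,
Thm. 13.3 (2) = Kontsevich's period conjecture for periods of curve type, rendered on explicit
period symbols `(Z, ω, γ)` with the elementary relations (R1)–(R5); general statement: the named
fact `HuberWustholzCurvePeriods`) and the two-lattice generalization of
`CurvePeriodsEllipticCMIsogenyProofs.lean` (which is the case `M = L`): for period pairs `L`, `M`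
with algebraic invariants and an ISOGENY `[α] : E_L → E_M`, `z ↦ αz` (`α ≠ 0` algebraic,
`αΛ_L ⊆ Λ_M`), the `ℚ̄`-linear relations between the periods of `E_L` and `E_M` induced by
functoriality along `[α]` are elementary relations of the rendering:

* `Ell.Isog.Reps L M α S` — kernel data (representatives `S ∋ 0` of `α⁻¹Λ_M/Λ_L`,
  `Ell.Isog.exists_reps` from `PeriodPair.exists_finset_representatives`); the representatives
  are torsion points of `ℂ/Λ_L` (pigeonhole), hence algebraic points (`Reps.isAlgPt_rep`);
  the transformation formula `α²℘_M(αz) = Σ_{c ∈ S} ℘_L(z − c) − Σ_{c ≠ 0} ℘_L(c)`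
  (`Reps.transformation`: `PeriodPair.weierstrassP_transformation` + homogeneity);
* `Ell.curveC L S = C_α ⊂ 𝔸³` (`E_L` minus `ker [α]`), `Ell.cmul L α S = [α] : C_α → E_M`
  as a POLYNOMIAL map with `[α](ψ(z)) = φ_M(αz)` (`Reps.cmul_psiC`), mapping algebraic points to
  algebraic points (`Reps.isAlgPt_mul`);
* the identities on `C_α`: `[α]^*θ₀^M = α ι^*θ₀^L` (`Reps.vanishesOn_nuC0`) and
  `[α]^*θ₁^M = (|S|/α) ι^*θ₁^L − (K/α) ι^*θ₀^L − dG` (`Reps.vanishesOn_nuC1`);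
* **the isogeny relations** `Reps.span_cmul_theta0`, `Reps.span_cmul_theta1`: for every `C¹` map
  `g : [0,1] → ℂ` avoiding `α⁻¹Λ_M` with algebraic end points,
  `(E_M, θ₀, φ_M∘(αg)) ∼ α (E_L, θ₀, φ_L∘g)` and
  `(E_M, θ₁, φ_M∘(αg)) ∼ (|S|/α)(E_L, θ₁, φ_L∘g) − (K/α)(E_L, θ₀, φ_L∘g) − (G(ψ(g 1)) − G(ψ(g 0)))·𝟙`.

Everything that depends only on the source data `(L, α, S)` — the kernel polynomial `Q`, the curve
`C_α`, `ψ`, the transformation polynomial `P`, the map `cmul`, `G`, the coefficients `|S|/α`, `−K/α`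
and their `M`-free lemmas — is REUSED from the CM file (`Ell.qfun`, …, `Ell.aC`); the algebraicity
lemmas are restated once over the one-lattice data "the `c ∈ S ∖ 0` are algebraic points, `α ∈ ℚ̄`"
(`…_of`, section `OneLattice`), and only the statements that mention the target lattice `M` are
new. Consequence (`CurvePeriodsEllipticIsogenousPathsProofs.lean`): Theorem 13.3 (2) for several
pairwise isogenous non-CM elliptic curves with arbitrary paths.

## References

* A. Huber, G. Wüstholz, *Transcendence and Linear Relations of 1-Periods*, Cambridge Tracts in
  Mathematics 227, CUP 2022 [HuberWustholz2022]: Thm. 13.3 (2) (p. 121 of the held text), §13.1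
  (A)–(B) (p. 120), §13.2 (pp. 122–125), §18.1 (p. 160).
* D. F. Lawden, *Elliptic Functions and Applications*, Springer 1989, §9.8 (transformations of
  `℘`). [Lawden1989]
* J. H. Silverman, *The Arithmetic of Elliptic Curves*, 2nd ed., GTM 106, 2009, III.4, VI.4.1
  (isogenies of complex tori `z ↦ αz`). [SilvermanAEC2009]
* D. A. Cox, *Primes of the form x² + ny²*, 2nd ed., Wiley 2013, §10.B Thm. 10.14. [Cox2013]
* J. V. Armitage, W. F. Eberlein, *Elliptic Functions*, CUP 2006, §7.4.2. [ArmitageEberlein2001]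
-/

noncomputable section

open scoped BigOperators
open scoped PeriodPair
open scoped Topology
open MvPolynomial Set Complex Filter

namespace Literature.NumberTheory.Transcendental

namespace CurvePeriods

set_option quotPrecheck false in
/-- Membership in the `ℚ̄`-span of the elementary relations, in the format of the conclusion of
`HuberWustholzCurvePeriods`. -/
local notation "InSpan" c:max => ∃ (k : ℕ) (ρ : Fin k → (PeriodSymbol →₀ ℂ)) (a : Fin k → ℂ),
  (∀ l, IsElementaryRelation (ρ l)) ∧ (∀ l, IsAlgebraic ℚ (a l)) ∧ c = ∑ l, a l • ρ l

namespace Ell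

namespace Isog

variable (L M : PeriodPair) (α : ℂ) (S : Finset ℂ)

/-! ### Isogenies `z ↦ αz : ℂ/Λ → ℂ/Λ′` and representatives of their kernels -/

/-- **Kernel data of an isogeny** `[α] : E_L → E_M`, `z ↦ αz` (`α ≠ 0` algebraic, `αΛ_L ⊆ Λ_M`):
a finite system of representatives `S ∋ 0` of `α⁻¹Λ_M/Λ_L` (`αx ∈ Λ_M ↔ x ≡ c (mod Λ_L)` for some
`c ∈ S`, the `c ∈ S` pairwise incongruent modulo `Λ_L`) — the kernel of `[α]` is
`{φ_L(c) | c ∈ S}`. Such `S` exists (`exists_reps`). The case `M = L` is a complex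
multiplication (`CurvePeriodsEllipticCMIsogenyProofs.lean`, `Ell.CMReps`). (Every isogeny
between elliptic curves over `ℚ̄` is of this form with `α ∈ ℚ̄` — it acts on the invariant
differentials, which are defined over `ℚ̄` — but the algebraicity of `α` is taken as part of the
data here.) [cite: SilvermanAEC2009, III.4 and VI.4.1] [cite: Lawden1989, §9.8] -/
structure Reps : Prop where
  /-- `α ≠ 0`. -/
  ne_zero : α ≠ 0
  /-- `α ∈ ℚ̄`. -/
  algebraic : IsAlgebraic ℚ α
  /-- `αΛ_L ⊆ Λ_M`. -/
  mul_mem : ∀ l ∈ L.lattice, α * l ∈ M.lattice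
  /-- `0 ∈ S`. -/
  zero_mem : (0 : ℂ) ∈ S
  /-- `S` represents `α⁻¹Λ_M/Λ_L`. -/
  reps : ∀ x, α * x ∈ M.lattice ↔ ∃ c ∈ S, x - c ∈ L.lattice
  /-- The representatives are pairwise incongruent modulo `Λ_L`. -/
  distinct : ∀ c ∈ S, ∀ c' ∈ S, c - c' ∈ L.lattice → c = c'

/-- Kernel data exist for every `α ≠ 0` algebraic with `αΛ_L ⊆ Λ_M`
(`PeriodPair.exists_finset_representatives` for `Λ_L ⊆ α⁻¹Λ_M`). [folklore] -/
theorem exists_reps {L M : PeriodPair} {α : ℂ} (hα0 : α ≠ 0) (hα : IsAlgebraic ℚ α)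
    (hαL : ∀ l ∈ L.lattice, α * l ∈ M.lattice) : ∃ S : Finset ℂ, Reps L M α S := by
  set L'' : PeriodPair := M.mulLeft α⁻¹ (inv_ne_zero hα0) with hL''
  have hmem : ∀ x, x ∈ L''.lattice ↔ α * x ∈ M.lattice := fun x => by
    rw [hL'', PeriodPair.mem_mulLeft_inv_lattice hα0]
  have hle : L.lattice ≤ L''.lattice := fun x hx => (hmem x).2 (hαL x hx)
  obtain ⟨S, hS0, -, hS, hSd⟩ := L.exists_finset_representatives L'' hle
  exact ⟨S, ⟨hα0, hα, hαL, hS0, fun x => (hmem x).symm.trans (hS x), hSd⟩⟩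

namespace Reps

variable {L M α S} (hR : Reps L M α S)
include hR

/-- For `c ∈ S ∖ 0`: `αc ∈ Λ`. [folklore] -/
theorem mul_rep_mem {c : ℂ} (hc : c ∈ S.erase 0) : α * c ∈ M.lattice :=
  (hR.reps c).2 ⟨c, Finset.mem_of_mem_erase hc, by simp⟩

/-- For `c ∈ S ∖ 0`: `c ∉ Λ`. [folklore] -/
theorem rep_notMem {c : ℂ} (hc : c ∈ S.erase 0) : c ∉ L.lattice := fun h =>
  (Finset.ne_of_mem_erase hc) (hR.distinct c (Finset.mem_of_mem_erase hc) 0 hR.zero_mem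
    (by simpa using h))

/-- If `αz ∉ Λ` then `z ∉ Λ`. [folklore] -/
theorem notMem_of_mul_notMem {z : ℂ} (hz : α * z ∉ M.lattice) : z ∉ L.lattice :=
  fun h => hz (hR.mul_mem z h)

/-- If `αz ∉ Λ_M` and `c ∈ S ∖ 0`: `z − c, z + c ∉ Λ_L` and `℘_L(z) ≠ ℘_L(c)`. [folklore] -/
theorem ne_of_mul_notMem {z c : ℂ} (hz : α * z ∉ M.lattice) (hc : c ∈ S.erase 0) :
    z - c ∉ L.lattice ∧ z + c ∉ L.lattice ∧ ℘[L] z ≠ ℘[L] c := by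
  have hαc := hR.mul_rep_mem hc
  have hzc : z - c ∉ L.lattice := fun h => hz (by
    have e : α * z = α * (z - c) + α * c := by ring
    rw [e]; exact add_mem (hR.mul_mem _ h) hαc)
  have hzc' : z + c ∉ L.lattice := fun h => hz (by
    have e : α * z = α * (z + c) - α * c := by ring
    rw [e]; exact sub_mem (hR.mul_mem _ h) hαc)
  refine ⟨hzc, hzc', fun h => ?_⟩
  rcases (L.weierstrassP_eq_weierstrassP_iff (hR.notMem_of_mul_notMem hz) (hR.rep_notMem hc)).mp h
    with h' | h'
  · exact hzc' h'
  · exact hzc h'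

/-- Conversely: if `z ∉ Λ` and `℘(z) ≠ ℘(c)` for all `c ∈ S ∖ 0`, then `αz ∉ Λ`. [folklore] -/
theorem mul_notMem_of_ne {z : ℂ} (hz : z ∉ L.lattice) (hne : ∀ c ∈ S.erase 0, ℘[L] z ≠ ℘[L] c) :
    α * z ∉ M.lattice := by
  intro h
  obtain ⟨c, hcS, hzc⟩ := (hR.reps z).1 h
  have hc0 : c ≠ 0 := by
    rintro rfl
    exact hz (by simpa using hzc)
  have hc : c ∈ S.erase 0 := Finset.mem_erase.2 ⟨hc0, hcS⟩
  refine hne c hc ?_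
  have e : z = c + (z - c) := by ring
  rw [e]
  exact L.weierstrassP_add_coe c ⟨z - c, hzc⟩

/-- **Every representative is a torsion point of `ℂ/Λ_L`** (pigeonhole: among `0·c, 1·c, …, |S|·c`,
all in `α⁻¹Λ_M`, two have the same representative), so `φ_L(c)`, `c ∈ S ∖ 0`, is an algebraic
point (for `g₂(L), g₃(L) ∈ ℚ̄`). [folklore] -/
theorem isAlgPt_rep (h₂ : IsAlgebraic ℚ L.g₂) (h₃ : IsAlgebraic ℚ L.g₃) {c : ℂ}
    (hc : c ∈ S.erase 0) : IsAlgPt L c := by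
  classical
  have hαc := hR.mul_rep_mem hc
  -- the representative of `k • c`
  have hrep : ∀ k : ℕ, ∃ r ∈ S, (k : ℂ) * c - r ∈ L.lattice := fun k =>
    (hR.reps ((k : ℂ) * c)).1 (by
      rw [mul_left_comm]
      simpa [nsmul_eq_mul] using M.lattice.smul_mem (k : ℤ) hαc)
  choose r hrS hr using hrep
  obtain ⟨k₁, hk₁, k₂, hk₂, hne, heq⟩ := Finset.exists_ne_map_eq_of_card_lt_of_maps_to
    (s := Finset.range (S.card + 1)) (t := S) (f := r) (by simp) (fun k _ => hrS k)
  have hdiff : ((k₁ : ℂ) - k₂) * c ∈ L.lattice := by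
    have h := sub_mem (hr k₁) (hr k₂)
    rw [heq] at h
    have e : (k₁ : ℂ) * c - r k₂ - ((k₂ : ℂ) * c - r k₂) = ((k₁ : ℂ) - k₂) * c := by ring
    rwa [e] at h
  -- a positive multiple
  obtain ⟨N, hN0, hN⟩ : ∃ N : ℕ, 0 < N ∧ (N : ℂ) * c ∈ L.lattice := by
    rcases lt_or_gt_of_ne hne with h | h
    · refine ⟨k₂ - k₁, Nat.sub_pos_of_lt h, ?_⟩
      have e : ((k₂ - k₁ : ℕ) : ℂ) * c = -(((k₁ : ℂ) - k₂) * c) := by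
        push_cast [Nat.cast_sub h.le]
        ring
      rw [e]
      exact neg_mem hdiff
    · refine ⟨k₁ - k₂, Nat.sub_pos_of_lt h, ?_⟩
      have e : ((k₁ - k₂ : ℕ) : ℂ) * c = ((k₁ : ℂ) - k₂) * c := by
        push_cast [Nat.cast_sub h.le]
        ring
      rw [e]
      exact hdiff
  exact isAlgPt_of_torsion L h₂ h₃ (hR.rep_notMem hc) hN0 hN

/-- **The transformation formula of the isogeny**:
`α²℘_M(αz) = Σ_{c ∈ S} ℘_L(z − c) − Σ_{c ∈ S, c ≠ 0} ℘_L(c)` off `α⁻¹Λ_M` — the transformation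
of order `[α⁻¹Λ_M : Λ_L]` (`PeriodPair.weierstrassP_transformation`) for `Λ_L ⊆ α⁻¹Λ_M` and the
homogeneity `℘_{α⁻¹Λ_M}(z) = α²℘_{Λ_M}(αz)`. [cite: Lawden1989, §9.8 eq. (9.8.14)] -/
theorem transformation {z : ℂ} (hz : α * z ∉ M.lattice) :
    α ^ 2 * ℘[M] (α * z) = ∑ c ∈ S, ℘[L] (z - c) - ∑ c ∈ S.erase 0, ℘[L] c := by
  have hα0 := hR.ne_zero
  set L'' : PeriodPair := M.mulLeft α⁻¹ (inv_ne_zero hα0) with hL''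
  have hS'' : ∀ x, x ∈ L''.lattice ↔ ∃ c ∈ S, x - c ∈ L.lattice := fun x => by
    rw [hL'', PeriodPair.mem_mulLeft_inv_lattice hα0]
    exact hR.reps x
  have hz'' : z ∉ L''.lattice := by rwa [hL'', PeriodPair.mem_mulLeft_inv_lattice hα0]
  have ht := PeriodPair.weierstrassP_transformation (L := L) (L' := L'') hS'' hR.zero_mem
    hR.distinct hz''
  have hhom : ℘[L''] z = α ^ 2 * ℘[M] (α * z) := by
    have h := PeriodPair.weierstrassP_mulLeft α⁻¹ (inv_ne_zero hα0) M (α * z)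
    rw [← mul_assoc, inv_mul_cancel₀ hα0, one_mul] at h
    rw [hL'', h, inv_pow, inv_inv]
  rw [← hhom, ht]

/-- The sum `Σ_{c ∈ S} ℘_L(z − c)` is even in `z`: `Σ_c ℘_L(z + c) = Σ_c ℘_L(z − c)` off
`α⁻¹Λ_M` (it is `α²℘_M(αz)` plus a constant). [folklore] -/
theorem sum_weierstrassP_add_eq {z : ℂ} (hz : α * z ∉ M.lattice) :
    ∑ c ∈ S, ℘[L] (z + c) = ∑ c ∈ S, ℘[L] (z - c) := by
  have hz' : α * -z ∉ M.lattice := by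
    rw [mul_neg]
    exact fun h => hz (by simpa using neg_mem h)
  have h1 := hR.transformation hz
  have h2 := hR.transformation hz'
  rw [mul_neg, M.weierstrassP_neg] at h2
  have h3 : ∑ c ∈ S, ℘[L] (-z - c) = ∑ c ∈ S, ℘[L] (z + c) :=
    Finset.sum_congr rfl fun c _ => by rw [show -z - c = -(z + c) by ring, L.weierstrassP_neg]
  rw [h3] at h2
  linear_combination h1 - h2

end Reps

/-! ### The objects of the CM file, for the source lattice `L`

The kernel polynomial `Q`, the curve `C_α = Ell.curveC L S`, its parametrisation `ψ = Ell.psiC L S`,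
the transformation polynomial `P = Ell.PC L α S`, the map `cmul = Ell.cmul L α S`, the exact part
`G = Ell.GC L α S` and the coefficients `Ell.bC α S`, `Ell.aC L α S` depend only on `L, α, S` and are
REUSED from `CurvePeriodsEllipticCMIsogenyProofs.lean`, together with all their `M`-free lemmas. -/

variable {L M α S}

/-- `Q(℘(z)) ≠ 0` when `αz ∉ Λ`. [folklore] -/
theorem Reps.qfun_ne_zero (hR : Reps L M α S) {z : ℂ} (hz : α * z ∉ M.lattice) :
    qfun L S z ≠ 0 := by
  rw [qfun, Finset.prod_ne_zero_iff]
  exact fun c hc => pow_ne_zero 2 (sub_ne_zero.2 (hR.ne_of_mul_notMem hz hc).2.2)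

/-- Conversely `z ∉ Λ`, `Q(℘(z)) ≠ 0` force `αz ∉ Λ`. [folklore] -/
theorem Reps.mul_notMem_of_qfun_ne_zero (hR : Reps L M α S) {z : ℂ} (hz : z ∉ L.lattice)
    (hq : qfun L S z ≠ 0) : α * z ∉ M.lattice := by
  refine hR.mul_notMem_of_ne hz fun c hc h => hq ?_
  rw [qfun]
  exact Finset.prod_eq_zero hc (by rw [h, sub_self, zero_pow two_ne_zero])

/-! ### Algebraicity over the one-lattice data `(S, α)`

The following lemmas are stated over the two consequences of the kernel data that they use — the
representatives `c ∈ S ∖ 0` are algebraic points of `E_L`, and `α ∈ ℚ̄` — so that they serve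
complex multiplications (`Ell.CMReps`) and isogenies (`Ell.Isog.Reps`) alike. -/

section OneLattice

variable (hS : ∀ c ∈ S.erase 0, IsAlgPt L c)
include hS

/-- `D_c` is over `ℚ̄` for `c ∈ S ∖ 0`. [folklore] -/
theorem hasAlgCoeffs_Dc_of {c : ℂ} (hc : c ∈ S.erase 0) : HasAlgCoeffs (Dc L c) := by
  unfold Dc
  exact ((hasAlgCoeffs_X 0).sub (hasAlgCoeffs_C (hS c hc).weierstrassP)).pow 2

/-- `Q` is over `ℚ̄`. [folklore] -/
theorem hasAlgCoeffs_QC_of : HasAlgCoeffs (QC L S) := by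
  unfold QC
  exact hasAlgCoeffs_finsetProd _ (fun c => Dc L c) fun c hc => hasAlgCoeffs_Dc_of hS hc

/-- `K ∈ ℚ̄`. [folklore] -/
theorem isAlgebraic_KC_of : IsAlgebraic ℚ (KC L S) := by
  rw [KC]
  exact isAlgebraic_finsetSum _ _ fun c hc => (hS c hc).weierstrassP

/-- `N_c` is over `ℚ̄`. [folklore] -/
theorem hasAlgCoeffs_Nc_of (h₂ : IsAlgebraic ℚ L.g₂) (h₃ : IsAlgebraic ℚ L.g₃) {c : ℂ}
    (hc : c ∈ S.erase 0) : HasAlgCoeffs (Nc L c) := by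
  have he := (hS c hc).weierstrassP
  have h2 : IsAlgebraic ℚ (2 : ℂ) := isAlgebraic_nat 2
  refine (((hasAlgCoeffs_C (h2.mul he)).mul ((hasAlgCoeffs_X 0).pow 2)).add
    ((hasAlgCoeffs_C ?_).mul (hasAlgCoeffs_X 0))).sub (hasAlgCoeffs_C ?_)
  · exact (h2.mul (he.pow 2)).sub (h₂.mul h2.inv)
  · exact ((h₂.mul he).mul h2.inv).add h₃

/-- `P` is over `ℚ̄`. [folklore] -/
theorem hasAlgCoeffs_PC_of (hα : IsAlgebraic ℚ α) (h₂ : IsAlgebraic ℚ L.g₂)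
    (h₃ : IsAlgebraic ℚ L.g₃) : HasAlgCoeffs (PC L α S) := by
  have hQ := hasAlgCoeffs_QC_of hS
  refine (hasAlgCoeffs_C (hα.pow 2).inv).mul ((((hasAlgCoeffs_X 0).mul hQ).add
    ((hasAlgCoeffs_C ?_).mul (hasAlgCoeffs_finsetSum _ _ fun c hc => ?_))).sub
    ((hasAlgCoeffs_C (isAlgebraic_KC_of hS)).mul hQ))
  · rw [one_div]; exact (isAlgebraic_nat 2).inv
  · exact (hasAlgCoeffs_Nc_of hS h₂ h₃ hc).mul (hasAlgCoeffs_finsetProd _ (fun c' => Dc L c')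
      fun c' hc' => hasAlgCoeffs_Dc_of hS (Finset.mem_of_mem_erase hc'))

/-- `V` is over `ℚ̄`. [folklore] -/
theorem hasAlgCoeffs_VC_of (h₂ : IsAlgebraic ℚ L.g₂) : ∀ i, HasAlgCoeffs (VC L S i) := by
  have h2 : HasAlgCoeffs (C (2 : ℂ) : MvPolynomial (Fin 3) ℂ) := hasAlgCoeffs_C (isAlgebraic_nat 2)
  intro i
  fin_cases i
  · simpa [VC] using h2.mul (hasAlgCoeffs_X 1)
  · simpa [VC] using ((hasAlgCoeffs_C (isAlgebraic_nat 3)).mul ((hasAlgCoeffs_X 0).pow 2)).add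
      (hasAlgCoeffs_C (isAlgebraic_A L h₂))
  · show HasAlgCoeffs (-(∑ c ∈ S.erase 0, (∏ c' ∈ (S.erase 0).erase c, Dc L c') *
      (C 2 * (X 0 - C (℘[L] c)) * (C 2 * X 1))) * X 2 ^ 2)
    exact ((hasAlgCoeffs_finsetSum _ _ fun c hc =>
      (hasAlgCoeffs_finsetProd _ (fun c' => Dc L c') fun c' hc' =>
        hasAlgCoeffs_Dc_of hS (Finset.mem_of_mem_erase hc')).mul
      ((h2.mul ((hasAlgCoeffs_X 0).sub (hasAlgCoeffs_C
        (hS c hc).weierstrassP))).mul (h2.mul (hasAlgCoeffs_X 1))))).neg.mul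
      ((hasAlgCoeffs_X 2).pow 2)

/-- `x ∘ [α]` is over `ℚ̄`. [folklore] -/
theorem hasAlgCoeffs_cmulX_of (hα : IsAlgebraic ℚ α) (h₂ : IsAlgebraic ℚ L.g₂)
    (h₃ : IsAlgebraic ℚ L.g₃) : HasAlgCoeffs (cmulX L α S) :=
  (hasAlgCoeffs_PC_of hS hα h₂ h₃).mul (hasAlgCoeffs_X 2)

/-- `y ∘ [α]` is over `ℚ̄`. [folklore] -/
theorem hasAlgCoeffs_cmulY_of (hα : IsAlgebraic ℚ α) (h₂ : IsAlgebraic ℚ L.g₂)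
    (h₃ : IsAlgebraic ℚ L.g₃) : HasAlgCoeffs (cmulY L α S) :=
  (hasAlgCoeffs_C (hα.inv.mul (isAlgebraic_nat 2).inv)).mul
    (hasAlgCoeffs_finsetSum _ _ fun i _ =>
      ((hasAlgCoeffs_cmulX_of hS hα h₂ h₃).pderiv i).mul (hasAlgCoeffs_VC_of hS h₂ i))

/-- `cmul` is over `ℚ̄`. [folklore] -/
theorem hasAlgCoeffs_cmul_of (hα : IsAlgebraic ℚ α) (h₂ : IsAlgebraic ℚ L.g₂)
    (h₃ : IsAlgebraic ℚ L.g₃) : ∀ j, HasAlgCoeffs (cmul L α S j) := by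
  intro j
  fin_cases j
  · simpa [cmul] using hasAlgCoeffs_cmulX_of hS hα h₂ h₃
  · simpa [cmul] using hasAlgCoeffs_cmulY_of hS hα h₂ h₃

/-- `λ_c` is over `ℚ̄`. [folklore] -/
theorem hasAlgCoeffs_lamC_of {c : ℂ} (hc : c ∈ S.erase 0) : HasAlgCoeffs (lamC L S c) := by
  have hP := hS c hc
  unfold lamC
  exact (((hasAlgCoeffs_X 1).add (hasAlgCoeffs_C (hP.derivWeierstrassP.mul
    (isAlgebraic_nat 2).inv))).mul (hasAlgCoeffs_X 2)).mul
    (((hasAlgCoeffs_X 0).sub (hasAlgCoeffs_C hP.weierstrassP)).mul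
      (hasAlgCoeffs_finsetProd _ (fun c' => Dc L c') fun c' hc' =>
        hasAlgCoeffs_Dc_of hS (Finset.mem_of_mem_erase hc')))

/-- `G` is over `ℚ̄`. [folklore] -/
theorem hasAlgCoeffs_GC_of (hα : IsAlgebraic ℚ α) : HasAlgCoeffs (GC L α S) := by
  unfold GC
  refine (hasAlgCoeffs_C ?_).mul (hasAlgCoeffs_finsetSum _ (fun c => lamC L S c) fun c hc =>
    hasAlgCoeffs_lamC_of hS hc)
  rw [div_eq_mul_inv]
  exact (isAlgebraic_nat 2).mul hα.inv

/-- `a = −K/α ∈ ℚ̄`. [folklore] -/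
theorem isAlgebraic_aC_of (hα : IsAlgebraic ℚ α) : IsAlgebraic ℚ (aC L α S) := by
  rw [aC, div_eq_mul_inv]
  exact ((isAlgebraic_KC_of hS).mul hα.inv).neg

/-- `Q(℘(z)) ∈ ℚ̄` at an algebraic point. [folklore] -/
theorem isAlgebraic_qfun_of {z : ℂ} (hz : IsAlgPt L z) : IsAlgebraic ℚ (qfun L S z) := by
  have h : qfun L S z = eval (![℘[L] z, 0, 0]) (QC L S) := by rw [eval_QC]; rfl
  rw [h]
  refine (hasAlgCoeffs_QC_of hS).isAlgebraic_eval fun k => ?_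
  fin_cases k
  · simpa using hz.weierstrassP
  · simpa using isAlgebraic_zero
  · simpa using isAlgebraic_zero

/-- The coordinates of `ψ(z)` are algebraic at an algebraic point. [folklore] -/
theorem isAlgebraic_psiC_of {z : ℂ} (hz : IsAlgPt L z) : ∀ k, IsAlgebraic ℚ (psiC L S z k) := by
  intro k
  fin_cases k
  · simpa using hz.2 0
  · simpa using hz.2 1
  · simpa using (isAlgebraic_qfun_of hS hz).inv

/-- `G(ψ(z)) ∈ ℚ̄` at an algebraic point. [folklore] -/
theorem isAlgebraic_eval_GC_of (hα : IsAlgebraic ℚ α) {z : ℂ} (hz : IsAlgPt L z) :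
    IsAlgebraic ℚ (eval (psiC L S z) (GC L α S)) :=
  (hasAlgCoeffs_GC_of hS hα).isAlgebraic_eval (isAlgebraic_psiC_of hS hz)

/-- **`C_α` is a smooth affine curve over `ℚ̄`** (for `g₂, g₃ ∈ ℚ̄`): the two gradients
`(−f′, 2y, 0)`, `(w Q′, 0, Q)` are independent at every point (`Q(x) ≠ 0` on `C_α`, and
`(f′, y) ≠ 0` on a smooth Weierstrass curve), and no point is isolated. [folklore] -/
theorem smoothC_of (h₂ : IsAlgebraic ℚ L.g₂) (h₃ : IsAlgebraic ℚ L.g₃) :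
    (curveC L S).IsSmoothAffineCurve where
  algebraic j := by
    fin_cases j
    · simpa using ((hasAlgCoeffs_X (n := 3) 1).pow 2).sub (hasAlgCoeffs_fPoly3 L h₂ h₃)
    · simpa using ((hasAlgCoeffs_X (n := 3) 2).mul (hasAlgCoeffs_QC_of hS)).sub hasAlgCoeffs_one
  rank_eq q hq := by
    have hq' := hq
    rw [mem_points_curveC_iff] at hq
    obtain ⟨hcub, hw⟩ := hq
    have hx : (∏ c ∈ S.erase 0, (q 0 - ℘[L] c) ^ 2) ≠ 0 := fun h => by simp [h] at hw
    have hfun : (fun j => (curveC L S).gradient j q) =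
        ![![-(3 * q 0 ^ 2 + A L), 2 * q 1, 0],
          ![q 2 * eval q (pderiv 0 (QC L S)), 0, ∏ c ∈ S.erase 0, (q 0 - ℘[L] c) ^ 2]] := by
      funext j
      fin_cases j
      · simpa using gradient_curveC_zero L S q
      · simpa using gradient_curveC_one L S q
    have hli : LinearIndependent ℂ
        ![![-(3 * q 0 ^ 2 + A L), 2 * q 1, 0],
          ![q 2 * eval q (pderiv 0 (QC L S)), 0, ∏ c ∈ S.erase 0, (q 0 - ℘[L] c) ^ 2]] := by
      rw [LinearIndependent.pair_iff]
      intro s t hst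
      have h2 := congrFun hst 2
      have h1 := congrFun hst 1
      have h0 := congrFun hst 0
      simp only [Pi.add_apply, Pi.smul_apply, Matrix.cons_val_zero, Matrix.cons_val_one,
        Matrix.head_cons, smul_eq_mul, mul_zero, zero_add, add_zero, Pi.zero_apply,
        Matrix.cons_val_two, Matrix.tail_cons] at h0 h1 h2
      have ht : t = 0 := (mul_eq_zero.mp h2).resolve_right hx
      rw [ht, zero_mul, add_zero] at h0
      have hs : s = 0 := by
        by_contra hs
        have hy : q 1 = 0 := by
          rcases mul_eq_zero.mp h1 with h | h
          · exact absurd h hs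
          · exact (mul_eq_zero.mp h).resolve_left two_ne_zero
        have hf := fderiv_ne_zero_of_y_eq_zero L hcub hy
        rcases mul_eq_zero.mp h0 with h | h
        · exact hs h
        · exact hf (neg_eq_zero.mp h)
      exact ⟨hs, ht⟩
    rw [hfun, finrank_span_eq_card hli]
    rfl
  not_isolated q hq := by
    obtain ⟨z₀, hz₀, hq0, rfl⟩ := exists_psiC_eq hq
    exact psiC_mem_closure L S hz₀ hq0


end OneLattice

/-- `b = |S|/α ∈ ℚ̄`. [folklore] -/
theorem isAlgebraic_bC_of (hα : IsAlgebraic ℚ α) : IsAlgebraic ℚ (bC α S) := by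
  rw [bC, div_eq_mul_inv]
  exact (isAlgebraic_nat _).mul hα.inv

/-- The representatives are algebraic points (for `g₂(L), g₃(L) ∈ ℚ̄`). [folklore] -/
theorem Reps.isAlgPt_reps (hR : Reps L M α S) (h₂ : IsAlgebraic ℚ L.g₂) (h₃ : IsAlgebraic ℚ L.g₃) :
    ∀ c ∈ S.erase 0, IsAlgPt L c := fun _ hc => hR.isAlgPt_rep h₂ h₃ hc

/-! ### The transformation polynomial along the isogeny -/

/-- **`P(ψ(z)) = Q(℘(z)) · ℘(αz)`** for `αz ∉ Λ` — the transformation formula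
`α²℘(αz) = Σ_{c ∈ S} ℘(z − c) − Σ_{c ≠ 0} ℘(c)` (`PeriodPair.weierstrassP_mul_eq_sum_sub`),
symmetrised (`PeriodPair.sum_weierstrassP_add_eq`) and written in `℘(z)` by
`℘(z + c) + ℘(z − c) = N_c(℘ z)/(℘ z − e_c)²`. (The computation of
`PeriodPair.exists_rationalMap_of_mul_mem`, repeated for the explicit polynomials.)
[cite: Cox2013, §10.B Thm. 10.14 (proof, (ii) ⇒ (iii))] [cite: Lawden1989, §9.8 eq. (9.8.14)] -/
theorem Reps.eval_PC_psiC (hR : Reps L M α S) {z : ℂ} (hz : α * z ∉ M.lattice) :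
    eval (psiC L S z) (PC L α S) = qfun L S z * ℘[M] (α * z) := by
  classical
  have hα0 := hR.ne_zero
  set S' := S.erase 0 with hS'
  have hzΛ : z ∉ L.lattice := hR.notMem_of_mul_notMem hz
  have hne : ∀ c ∈ S', ℘[L] z - ℘[L] c ≠ 0 := fun c hc =>
    sub_ne_zero.2 (hR.ne_of_mul_notMem hz hc).2.2
  have hDcz : ∀ c ∈ S', eval (psiC L S z) (Dc L c) ≠ 0 := fun c hc => by
    simp only [Dc, map_pow, map_sub, eval_X, eval_C, psiC_apply_zero]
    exact pow_ne_zero 2 (hne c hc)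
  have hQz : eval (psiC L S z) (QC L S) = qfun L S z := eval_QC_psiC L S z
  have hQz0 : qfun L S z ≠ 0 := hR.qfun_ne_zero hz
  -- the symmetrised transformation formula
  have key : 2 * α ^ 2 * ℘[M] (α * z) =
      2 * ℘[L] z + ∑ c ∈ S', eval (psiC L S z) (Nc L c) / eval (psiC L S z) (Dc L c) -
        2 * KC L S := by
    have h1 := hR.transformation hz
    rw [← hS'] at h1
    have h2 := hR.sum_weierstrassP_add_eq hz
    have hsplit₁ : ∑ c ∈ S, ℘[L] (z - c) = ℘[L] z + ∑ c ∈ S', ℘[L] (z - c) := by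
      rw [hS', ← Finset.add_sum_erase S _ hR.zero_mem, sub_zero]
    have hsplit₂ : ∑ c ∈ S, ℘[L] (z + c) = ℘[L] z + ∑ c ∈ S', ℘[L] (z + c) := by
      rw [hS', ← Finset.add_sum_erase S _ hR.zero_mem, add_zero]
    have hsym : ∑ c ∈ S', eval (psiC L S z) (Nc L c) / eval (psiC L S z) (Dc L c) =
        ∑ c ∈ S', (℘[L] (z + c) + ℘[L] (z - c)) := by
      refine Finset.sum_congr rfl fun c hc => ?_
      obtain ⟨hzc, hzc', -⟩ := hR.ne_of_mul_notMem hz hc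
      rw [L.weierstrassP_add_add_weierstrassP_sub hzΛ (hR.rep_notMem hc) hzc hzc']
      simp only [Nc, Dc, map_add, map_sub, map_mul, map_pow, eval_C, eval_X, psiC_apply_zero]
    rw [hsym, Finset.sum_add_distrib, KC]
    linear_combination 2 * h1 + hsplit₁ - h2 + hsplit₂
  -- evaluate `P`
  have hfrac : ∀ c ∈ S', eval (psiC L S z) (Nc L c) *
      ∏ c' ∈ S'.erase c, eval (psiC L S z) (Dc L c') =
      eval (psiC L S z) (Nc L c) / eval (psiC L S z) (Dc L c) * qfun L S z := by
    intro c hc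
    have hQc : qfun L S z =
        eval (psiC L S z) (Dc L c) * ∏ c' ∈ S'.erase c, eval (psiC L S z) (Dc L c') := by
      rw [← hQz, QC, map_prod, ← Finset.mul_prod_erase S' _ hc]
    rw [hQc, ← mul_assoc, div_mul_cancel₀ _ (hDcz c hc)]
  have hsum : ∑ c ∈ S', eval (psiC L S z) (Nc L c) *
      ∏ c' ∈ S'.erase c, eval (psiC L S z) (Dc L c') =
      (∑ c ∈ S', eval (psiC L S z) (Nc L c) / eval (psiC L S z) (Dc L c)) * qfun L S z := by
    rw [Finset.sum_mul]
    exact Finset.sum_congr rfl hfrac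
  have hPz : eval (psiC L S z) (PC L α S) = (α ^ 2)⁻¹ * ((℘[L] z +
      1 / 2 * (∑ c ∈ S', eval (psiC L S z) (Nc L c) / eval (psiC L S z) (Dc L c)) - KC L S) *
        qfun L S z) := by
    rw [PC]
    simp only [map_mul, map_add, map_sub, eval_C, eval_X, map_sum, map_prod, psiC_apply_zero]
    rw [← hS', hsum, hQz]
    ring
  rw [hPz]
  apply mul_left_cancel₀ (pow_ne_zero 2 hα0)
  rw [← mul_assoc, mul_inv_cancel₀ (pow_ne_zero 2 hα0), one_mul]
  linear_combination -(qfun L S z / 2) * key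

/-! ### The isogeny `cmul = Ell.cmul L α S = [α] : C_α → E_M` -/

/-- `α(z + t) ∉ Λ` for small real `t` when `αz ∉ Λ`. [folklore] -/
theorem eventually_shift_mul_notMem {z : ℂ} (hz : α * z ∉ M.lattice) :
    ∀ᶠ t : ℝ in 𝓝 0, α * (z + (t : ℂ)) ∉ M.lattice := by
  have hc : Continuous fun t : ℝ => α * (z + (t : ℂ)) := by fun_prop
  have h : (M.lattice : Set ℂ)ᶜ ∈ 𝓝 (α * (z + ((0 : ℝ) : ℂ))) := by
    simpa using M.isClosed_lattice.isOpen_compl.mem_nhds hz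
  exact hc.continuousAt.preimage_mem_nhds h

/-- **`x([α](ψ(z))) = ℘(αz)`**: `P(℘ z) · Q(℘ z)⁻¹ = ℘(αz)`. [cite: Cox2013, §10.B Thm. 10.14] -/
theorem Reps.eval_cmulX_psiC (hR : Reps L M α S) {z : ℂ} (hz : α * z ∉ M.lattice) :
    eval (psiC L S z) (cmulX L α S) = ℘[M] (α * z) := by
  rw [cmulX, map_mul, eval_X, hR.eval_PC_psiC hz, psiC_apply_two, mul_assoc,
    mul_comm (℘[M] (α * z)), ← mul_assoc, mul_inv_cancel₀ (hR.qfun_ne_zero hz), one_mul]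

/-- **`Dx∘[α](ψ(z)) ψ′(z) = α℘′(αz)`**: the derivative at `t = 0` of
`t ↦ x([α](ψ(z + t))) = ℘(αz + tα)`. [folklore] -/
theorem Reps.pair_pderiv_cmulX (hR : Reps L M α S) {z : ℂ} (hz : α * z ∉ M.lattice) :
    ∑ i, eval (psiC L S z) (pderiv i (cmulX L α S)) * psiCD L S z i = ℘'[M] (α * z) * α := by
  have hzΛ := hR.notMem_of_mul_notMem hz
  have hq := hR.qfun_ne_zero hz
  have hD := hasDerivAt_eval_psiC_shift hzΛ hq (cmulX L α S)
  have hE : (fun t : ℝ => phi M (α * z + t * α) 0) =ᶠ[𝓝 0]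
      fun t : ℝ => eval (psiC L S (z + t)) (cmulX L α S) := by
    filter_upwards [eventually_shift_mul_notMem hz] with t ht
    rw [hR.eval_cmulX_psiC ht, phi_apply_zero, mul_add, mul_comm α (t : ℂ)]
  have hD2 : HasDerivAt (fun t : ℝ => phi M (α * z + t * α) 0)
      (phiD M (α * z + ((0 : ℝ) : ℂ) * α) 0 * α) 0 :=
    hasDerivAt_phi_line M (α * z) α (by simpa using hz) 0
  have h := hD.unique (hD2.congr_of_eventuallyEq hE.symm)
  rw [h]
  simp

/-- **`y([α](ψ(z))) = ℘′(αz)/2`.** [folklore] -/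
theorem Reps.eval_cmulY_psiC (hR : Reps L M α S) {z : ℂ} (hz : α * z ∉ M.lattice) :
    eval (psiC L S z) (cmulY L α S) = ℘'[M] (α * z) / 2 := by
  rw [cmulY, map_mul, eval_C, map_sum]
  have e : ∑ i, eval (psiC L S z) (pderiv i (cmulX L α S) * VC L S i) =
      ∑ i, eval (psiC L S z) (pderiv i (cmulX L α S)) * psiCD L S z i :=
    Finset.sum_congr rfl fun i _ => by rw [map_mul, eval_VC]
  rw [e, hR.pair_pderiv_cmulX hz]
  field_simp [hR.ne_zero]

/-- **`[α](ψ(z)) = φ(αz)`.** [cite: Cox2013, §10.B Thm. 10.14] -/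
theorem Reps.cmul_psiC (hR : Reps L M α S) {z : ℂ} (hz : α * z ∉ M.lattice) :
    (fun j => eval (psiC L S z) (cmul L α S j)) = phi M (α * z) := by
  funext j
  fin_cases j
  · simpa [cmul] using hR.eval_cmulX_psiC hz
  · simpa [cmul] using hR.eval_cmulY_psiC hz

/-- `[α]` maps `C_α` into `E_L`. [folklore] -/
theorem Reps.cmul_mapsTo (hR : Reps L M α S) :
    ∀ q ∈ (curveC L S).points, (fun j => eval q (cmul L α S j)) ∈ (curve M).points := by
  intro q hq
  obtain ⟨z, hz, hqz, rfl⟩ := exists_psiC_eq hq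
  have hαz := hR.mul_notMem_of_qfun_ne_zero hz hqz
  rw [hR.cmul_psiC hαz]
  exact phi_mem_points M hαz

/-- **`D[α](ψ(z)) ψ′(z) = α φ′(αz)`**: the derivative at `t = 0` of `t ↦ [α](ψ(z + t)) = φ(αz + tα)`.
[folklore] -/
theorem Reps.pair_pderiv_cmul (hR : Reps L M α S) {z : ℂ} (hz : α * z ∉ M.lattice) (j : Fin 2) :
    ∑ i, eval (psiC L S z) (pderiv i (cmul L α S j)) * psiCD L S z i = phiD M (α * z) j * α := by
  have hzΛ := hR.notMem_of_mul_notMem hz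
  have hq := hR.qfun_ne_zero hz
  have hD := hasDerivAt_eval_psiC_shift hzΛ hq (cmul L α S j)
  have hE : (fun t : ℝ => phi M (α * z + t * α) j) =ᶠ[𝓝 0]
      fun t : ℝ => eval (psiC L S (z + t)) (cmul L α S j) := by
    filter_upwards [eventually_shift_mul_notMem hz] with t ht
    rw [show α * z + (t : ℂ) * α = α * (z + (t : ℂ)) by ring]
    exact (congrFun (hR.cmul_psiC ht) j).symm
  have hD2 : HasDerivAt (fun t : ℝ => phi M (α * z + t * α) j)
      (phiD M (α * z + ((0 : ℝ) : ℂ) * α) j * α) 0 :=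
    hasDerivAt_phi_line M (α * z) α (by simpa using hz) j
  have h := hD.unique (hD2.congr_of_eventuallyEq hE.symm)
  rw [h]
  simp

/-! ### The exact part `G = Ell.GC L α S` along the isogeny -/

section Lam

variable (hR : Reps L M α S)
include hR

/-- `λ_c(ψ(z)) = ½ (℘′(z) + ℘′(c))/(℘(z) − ℘(c))` for `αz ∉ Λ`. [folklore] -/
theorem Reps.eval_lamC_psiC {z c : ℂ} (hz : α * z ∉ M.lattice) (hc : c ∈ S.erase 0) :
    eval (psiC L S z) (lamC L S c) = (℘'[L] z + ℘'[L] c) / (℘[L] z - ℘[L] c) / 2 := by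
  classical
  have hne : ℘[L] z - ℘[L] c ≠ 0 := sub_ne_zero.2 (hR.ne_of_mul_notMem hz hc).2.2
  set R := ∏ c' ∈ (S.erase 0).erase c, (℘[L] z - ℘[L] c') ^ 2 with hRdef
  have hQ : qfun L S z = (℘[L] z - ℘[L] c) ^ 2 * R := by
    rw [qfun, ← Finset.mul_prod_erase _ _ hc]
  have hR0 : R ≠ 0 := by
    intro h
    exact hR.qfun_ne_zero hz (by rw [hQ, h, mul_zero])
  simp only [lamC, map_mul, map_add, map_sub, map_prod, map_pow, eval_X, eval_C, psiC_apply_zero,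
    psiC_apply_one, psiC_apply_two, Dc]
  rw [← hRdef, hQ]
  field_simp

/-- `λ_c(ψ(z)) = ζ(z − c) − ζ(z) + ζ(c)` (the addition theorem for `ζ`,
`PeriodPair.weierstrassZeta_add_holds`, at `(z, −c)`). [cite: ArmitageEberlein2001, §7.4.2] -/
theorem Reps.eval_lamC_psiC_eq_zeta {z c : ℂ} (hz : α * z ∉ M.lattice) (hc : c ∈ S.erase 0) :
    eval (psiC L S z) (lamC L S c) =
      L.weierstrassZeta (z - c) - L.weierstrassZeta z + L.weierstrassZeta c := by
  have hzΛ := hR.notMem_of_mul_notMem hz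
  have hcΛ := hR.rep_notMem hc
  have hc' : -c ∉ L.lattice := fun h => hcΛ (by simpa using neg_mem h)
  have hne := (hR.ne_of_mul_notMem hz hc).2.2
  have hne' : ℘[L] z ≠ ℘[L] (-c) := by rwa [L.weierstrassP_neg]
  have h := L.weierstrassZeta_add_holds z (-c) hzΛ hc' hne'
  rw [L.weierstrassP_neg, L.derivWeierstrassP_neg, L.weierstrassZeta_neg, ← sub_eq_add_neg] at h
  rw [hR.eval_lamC_psiC hz hc, h]
  ring

/-- `G(ψ(z)) = (2/α) Σ_{c ≠ 0} (ζ(z − c) − ζ(z) + ζ(c))`. [folklore] -/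
theorem Reps.eval_GC_psiC {z : ℂ} (hz : α * z ∉ M.lattice) :
    eval (psiC L S z) (GC L α S) = 2 / α * ∑ c ∈ S.erase 0,
      (L.weierstrassZeta (z - c) - L.weierstrassZeta z + L.weierstrassZeta c) := by
  rw [GC, map_mul, eval_C, map_sum]
  congr 1
  exact Finset.sum_congr rfl fun c hc => hR.eval_lamC_psiC_eq_zeta hz hc

/-- **`DG(ψ(z)) ψ′(z) = (2/α) Σ_{c ≠ 0} (℘(z) − ℘(z − c))`** (`ζ′ = −℘`). [folklore] -/
theorem Reps.pair_pderiv_GC {z : ℂ} (hz : α * z ∉ M.lattice) :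
    ∑ i, eval (psiC L S z) (pderiv i (GC L α S)) * psiCD L S z i =
      2 / α * ∑ c ∈ S.erase 0, (℘[L] z - ℘[L] (z - c)) := by
  have hzΛ := hR.notMem_of_mul_notMem hz
  have hq := hR.qfun_ne_zero hz
  have hD := hasDerivAt_eval_psiC_shift hzΛ hq (GC L α S)
  -- `ζ′ = −℘` off the lattice
  have hζ : ∀ w, w ∉ L.lattice → HasDerivAt L.weierstrassZeta (-℘[L] w) w := fun w hw => by
    have hd : DifferentiableAt ℂ L.weierstrassZeta w :=
      L.differentiableOn_weierstrassZeta_holds.differentiableAt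
        (L.isClosed_lattice.isOpen_compl.mem_nhds hw)
    rw [← L.deriv_weierstrassZeta_holds w hw]
    exact hd.hasDerivAt
  have hE : (fun t : ℝ => 2 / α * ∑ c ∈ S.erase 0, (L.weierstrassZeta (z - c + t) -
      L.weierstrassZeta (z + t) + L.weierstrassZeta c)) =ᶠ[𝓝 0]
      fun t : ℝ => eval (psiC L S (z + t)) (GC L α S) := by
    filter_upwards [eventually_shift_mul_notMem hz] with t ht
    rw [hR.eval_GC_psiC ht]
    congr 1
    refine Finset.sum_congr rfl fun c _ => ?_
    rw [show z + (t : ℂ) - c = z - c + t by ring]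
  have hsummand : ∀ c ∈ S.erase 0, HasDerivAt (fun t : ℝ => L.weierstrassZeta (z - c + t) -
      L.weierstrassZeta (z + t) + L.weierstrassZeta c) (-℘[L] (z - c) * 1 - -℘[L] z * 1) 0 := by
    intro c hc
    have hzc : z - c ∉ L.lattice := (hR.ne_of_mul_notMem hz hc).1
    have h1 : HasDerivAt (fun t : ℝ => L.weierstrassZeta (z - c + t)) (-℘[L] (z - c) * 1) 0 := by
      have hin : HasDerivAt (fun s : ℂ => z - c + s) 1 ((0 : ℝ) : ℂ) := by
        simpa using (hasDerivAt_id (((0 : ℝ) : ℂ))).const_add (z - c)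
      have h := ((hζ _ (by simpa using hzc)).comp ((0 : ℝ) : ℂ) hin).comp_ofReal
      simpa using h
    have h2 : HasDerivAt (fun t : ℝ => L.weierstrassZeta (z + t)) (-℘[L] z * 1) 0 := by
      have hin : HasDerivAt (fun s : ℂ => z + s) 1 ((0 : ℝ) : ℂ) := by
        simpa using (hasDerivAt_id (((0 : ℝ) : ℂ))).const_add z
      have h := ((hζ _ (by simpa using hzΛ)).comp ((0 : ℝ) : ℂ) hin).comp_ofReal
      simpa using h
    exact (h1.sub h2).add_const _
  have hD2 := (HasDerivAt.fun_sum hsummand).const_mul (2 / α)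
  have h := hD.unique (hD2.congr_of_eventuallyEq hE.symm)
  rw [h]
  congr 1
  refine Finset.sum_congr rfl fun c _ => ?_
  ring

end Lam

/-! ### The identities of forms on `C_α` -/

variable (L M α S)

/-- `ν₀ = [α]^*θ₀ − α · ι^*θ₀`. [folklore] -/
def nuC0 : Fin 3 → MvPolynomial (Fin 3) ℂ :=
  formPullback (cmul L α S) (theta0 M) - α • formPullback iota (theta0 L)

/-- `ν₁ = [α]^*θ₁ − b · ι^*θ₁ − a · ι^*θ₀ + dG`. [folklore] -/
def nuC1 : Fin 3 → MvPolynomial (Fin 3) ℂ :=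
  formPullback (cmul L α S) (theta1 M) - bC α S • formPullback iota (theta1 L) -
    aC L α S • formPullback iota (theta0 L) + formD (GC L α S)

variable {L M α S}

section Forms

variable (hR : Reps L M α S)
include hR

/-- **`[α]^*θ₀ = α ι^*θ₀` on `C_α`** (`[α]^* dz = α dz`): `ν₀` vanishes on `C_α`.
[cite: HuberWustholz2022, §18.1 (p. 160)] [cite: SilvermanAEC2009, III.5.1] -/
theorem Reps.vanishesOn_nuC0 (hE : (curveC L S).IsSmoothAffineCurve) :
    VanishesOn (curveC L S) (nuC0 L M α S) := by
  refine vanishesOn_curveC_of_psi hE _ fun z hzΛ hq => ?_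
  have hz : α * z ∉ M.lattice := hR.mul_notMem_of_qfun_ne_zero hzΛ hq
  have e : ∀ i, eval (psiC L S z) (nuC0 L M α S i) * psiCD L S z i =
      eval (psiC L S z) (formPullback (cmul L α S) (theta0 M) i) * psiCD L S z i -
        α * (eval (psiC L S z) (formPullback iota (theta0 L) i) * psiCD L S z i) := fun i => by
    simp only [nuC0, Pi.sub_apply, Pi.smul_apply, map_sub, smul_eval]
    ring
  rw [Finset.sum_congr rfl fun i _ => e i, Finset.sum_sub_distrib, ← Finset.mul_sum,
    formPullback_pair, formPullback_pair, hR.cmul_psiC hz, iota_psiC]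
  have hs1 : ∑ j, eval (phi M (α * z)) (theta0 M j) *
      (∑ i, eval (psiC L S z) (pderiv i (cmul L α S j)) * psiCD L S z i) =
      α * ∑ j, eval (phi M (α * z)) (theta0 M j) * phiD M (α * z) j := by
    rw [Finset.mul_sum]
    exact Finset.sum_congr rfl fun j _ => by rw [hR.pair_pderiv_cmul hz j]; ring
  have hs2 : ∑ j, eval (phi L z) (theta0 L j) *
      (∑ i, eval (psiC L S z) (pderiv i (iota j)) * psiCD L S z i) =
      ∑ j, eval (phi L z) (theta0 L j) * phiD L z j :=
    Finset.sum_congr rfl fun j _ => by rw [pair_pderiv_iota_C z j]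
  rw [hs1, hs2, theta0_phi M hz, theta0_phi L hzΛ, sub_self]

/-- **`[α]^*θ₁ = (|S|/α) ι^*θ₁ − (K/α) ι^*θ₀ − dG` on `C_α`** (`α℘(αz)dz =
(|S|/α)℘(z)dz − (K/α)dz − dG(ψ(z))`, the transformation formula
`α²℘(αz) = ℘(z) + Σ_{c ≠ 0} ℘(z − c) − K`): `ν₁` vanishes on `C_α`.
[cite: Lawden1989, §9.8 eq. (9.8.14)] [cite: HuberWustholz2022, §18.1 (p. 160)] -/
theorem Reps.vanishesOn_nuC1 (hE : (curveC L S).IsSmoothAffineCurve) :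
    VanishesOn (curveC L S) (nuC1 L M α S) := by
  classical
  refine vanishesOn_curveC_of_psi hE _ fun z hzΛ hq => ?_
  have hz : α * z ∉ M.lattice := hR.mul_notMem_of_qfun_ne_zero hzΛ hq
  have hα0 := hR.ne_zero
  have e : ∀ i, eval (psiC L S z) (nuC1 L M α S i) * psiCD L S z i =
      eval (psiC L S z) (formPullback (cmul L α S) (theta1 M) i) * psiCD L S z i -
        bC α S * (eval (psiC L S z) (formPullback iota (theta1 L) i) * psiCD L S z i) -
        aC L α S * (eval (psiC L S z) (formPullback iota (theta0 L) i) * psiCD L S z i) +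
        eval (psiC L S z) (pderiv i (GC L α S)) * psiCD L S z i := fun i => by
    simp only [nuC1, formD, Pi.sub_apply, Pi.add_apply, Pi.smul_apply, map_sub, map_add, smul_eval]
    ring
  rw [Finset.sum_congr rfl fun i _ => e i, Finset.sum_add_distrib, Finset.sum_sub_distrib,
    Finset.sum_sub_distrib, ← Finset.mul_sum, ← Finset.mul_sum,
    formPullback_pair, formPullback_pair, formPullback_pair, hR.cmul_psiC hz, iota_psiC,
    hR.pair_pderiv_GC hz]
  have hs1 : ∑ j, eval (phi M (α * z)) (theta1 M j) *
      (∑ i, eval (psiC L S z) (pderiv i (cmul L α S j)) * psiCD L S z i) =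
      α * ∑ j, eval (phi M (α * z)) (theta1 M j) * phiD M (α * z) j := by
    rw [Finset.mul_sum]
    exact Finset.sum_congr rfl fun j _ => by rw [hR.pair_pderiv_cmul hz j]; ring
  have hs2 : ∑ j, eval (phi L z) (theta1 L j) *
      (∑ i, eval (psiC L S z) (pderiv i (iota j)) * psiCD L S z i) =
      ∑ j, eval (phi L z) (theta1 L j) * phiD L z j :=
    Finset.sum_congr rfl fun j _ => by rw [pair_pderiv_iota_C z j]
  have hs3 : ∑ j, eval (phi L z) (theta0 L j) *
      (∑ i, eval (psiC L S z) (pderiv i (iota j)) * psiCD L S z i) =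
      ∑ j, eval (phi L z) (theta0 L j) * phiD L z j :=
    Finset.sum_congr rfl fun j _ => by rw [pair_pderiv_iota_C z j]
  rw [hs1, hs2, hs3, theta1_phi M hz, theta1_phi L hzΛ, theta0_phi L hzΛ]
  -- the transformation formula
  have h1 := hR.transformation hz
  have hsplit : ∑ c ∈ S, ℘[L] (z - c) = ℘[L] z + ∑ c ∈ S.erase 0, ℘[L] (z - c) := by
    rw [← Finset.add_sum_erase S _ hR.zero_mem, sub_zero]
  have hcard : (S.card : ℂ) = (S.erase 0).card + 1 := by
    rw [← Finset.card_erase_add_one hR.zero_mem]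
    push_cast
    ring
  have hsum' : ∑ c ∈ S.erase 0, (℘[L] z - ℘[L] (z - c)) =
      (S.erase 0).card * ℘[L] z - ∑ c ∈ S.erase 0, ℘[L] (z - c) := by
    rw [Finset.sum_sub_distrib, Finset.sum_const, nsmul_eq_mul]
  rw [hsum']
  simp only [bC, aC, KC]
  rw [hsplit] at h1
  field_simp
  linear_combination 2 * h1 - 2 * ℘[L] z * hcard

end Forms

/-! ### Algebraic points and the lifted path `ψ ∘ g` on `C_α` -/

/-- **`αz` is an algebraic point if `z` is** (and `αz ∉ Λ`): `φ(αz) = [α](ψ(z))` with `[α]` over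
`ℚ̄` — the isogeny is defined over `ℚ̄`. [cite: SilvermanAEC2009, III.4] -/
theorem Reps.isAlgPt_mul (hR : Reps L M α S) (h₂ : IsAlgebraic ℚ L.g₂) (h₃ : IsAlgebraic ℚ L.g₃)
    {z : ℂ} (hz : IsAlgPt L z) (hαz : α * z ∉ M.lattice) : IsAlgPt M (α * z) := by
  refine ⟨hαz, fun k => ?_⟩
  rw [← congrFun (hR.cmul_psiC hαz) k]
  exact (hasAlgCoeffs_cmul_of (hR.isAlgPt_reps h₂ h₃) hR.algebraic h₂ h₃ k).isAlgebraic_eval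
    (isAlgebraic_psiC_of (hR.isAlgPt_reps h₂ h₃) hz)

/-- **The lifted path `ψ ∘ g` on `C_α`**, for a `C¹` map `g` whose values on `[0,1]` avoid `α⁻¹Λ`,
with algebraic end points. [folklore] -/
def Reps.liftPathC (hR : Reps L M α S) (h₂ : IsAlgebraic ℚ L.g₂) (h₃ : IsAlgebraic ℚ L.g₃)
    (g : ℝ → ℂ) (hg : ContDiff ℝ 1 g) (hα : ∀ t ∈ Icc (0 : ℝ) 1, α * g t ∉ M.lattice)
    (h0 : IsAlgPt L (g 0)) (h1 : IsAlgPt L (g 1)) : CurvePath (curveC L S) where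
  toFun t := psiC L S (g t)
  contDiffOn := by
    have hΛ : ∀ t ∈ Icc (0 : ℝ) 1, g t ∉ L.lattice := fun t ht => hR.notMem_of_mul_notMem (hα t ht)
    have hφ : ∀ k : Fin 2, ContDiffOn ℝ 1 (fun t => phi L (g t) k) (Icc 0 1) := fun k =>
      (contDiffOn_phi L k).comp hg.contDiffOn fun t ht => hΛ t ht
    have hx := hφ 0
    have hy := hφ 1
    simp only [phi_apply_zero, phi_apply_one] at hx hy
    have hγ : ContDiffOn ℝ 1 (fun t => (![℘[L] (g t), 0, 0] : Fin 3 → ℂ)) (Icc 0 1) := by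
      refine contDiffOn_pi.2 fun k => ?_
      fin_cases k
      · exact hx
      · exact contDiffOn_const
      · exact contDiffOn_const
    have hq : ContDiffOn ℝ 1 (fun t => qfun L S (g t)) (Icc 0 1) := by
      have h := contDiffOn_eval_comp hγ (QC L S)
      refine h.congr fun t _ => ?_
      rw [eval_QC]
      rfl
    refine contDiffOn_pi.2 fun k => ?_
    fin_cases k
    · exact hx
    · exact hy
    · exact hq.inv fun t ht => hR.qfun_ne_zero (hα t ht)
  mem_points t ht := psiC_mem_points L S (hR.notMem_of_mul_notMem (hα t ht))
    (hR.qfun_ne_zero (hα t ht))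
  algebraic_zero k := isAlgebraic_psiC_of (hR.isAlgPt_reps h₂ h₃) h0 k
  algebraic_one k := isAlgebraic_psiC_of (hR.isAlgPt_reps h₂ h₃) h1 k

/-- The parametrisation of `liftPathC`. [folklore] -/
@[simp] theorem Reps.liftPathC_toFun (hR : Reps L M α S) (h₂ : IsAlgebraic ℚ L.g₂)
    (h₃ : IsAlgebraic ℚ L.g₃) (g : ℝ → ℂ) (hg : ContDiff ℝ 1 g)
    (hα : ∀ t ∈ Icc (0 : ℝ) 1, α * g t ∉ M.lattice) (h0 : IsAlgPt L (g 0)) (h1 : IsAlgPt L (g 1))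
    (t : ℝ) : (hR.liftPathC h₂ h₃ g hg hα h0 h1).toFun t = psiC L S (g t) := rfl

/-! ### Complex multiplication is functoriality: the relations -/

section Relations

variable (hR : Reps L M α S) (h₂ : IsAlgebraic ℚ L.g₂) (h₃ : IsAlgebraic ℚ L.g₃)
  (h₂' : IsAlgebraic ℚ M.g₂) (h₃' : IsAlgebraic ℚ M.g₃)
include hR h₂ h₃ h₂' h₃'

/-- **The isogeny relation for `θ₀ = dx/y`.** Let `[α] : E_L → E_M` be an isogeny (`αΛ_L ⊆ Λ_M`,
`α ≠ 0` algebraic) and `g : [0,1] → ℂ` a `C¹` map avoiding `α⁻¹Λ_M` with algebraic end points.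
Then `(E_M, θ₀, φ_M∘(αg)) − α · (E_L, θ₀, φ_L∘g)` lies in the `ℚ̄`-span of the elementary
relations: functoriality (R4) along `[α] : C_α → E_M` and along `ι : C_α → E_L`, with
`[α]^*θ₀ = α ι^*θ₀` in `Ω¹(C_α)`. This is the relation `∫_{[α]γ} dx/y = α ∫_γ dx/y` between the
periods of isogenous curves ("induced by functoriality", Huber–Wüstholz 2022, Thm. 13.3 (2)).
[cite: HuberWustholz2022, Thm. 13.3 (2) (p. 121), §13.1 (B) (p. 120), §18.1 (p. 160)] [cite: Cox2013, §10.B Thm. 10.14] -/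
theorem Reps.span_cmul_theta0 {g : ℝ → ℂ} (hg : ContDiff ℝ 1 g)
    (hαg : ∀ t ∈ Icc (0 : ℝ) 1, α * g t ∉ M.lattice)
    (hΛ : ∀ t ∈ Icc (0 : ℝ) 1, g t ∉ L.lattice)
    (h0 : IsAlgPt L (g 0)) (h1 : IsAlgPt L (g 1))
    (hg' : ContDiff ℝ 1 fun t => α * g t)
    (h0' : IsAlgPt M (α * g 0)) (h1' : IsAlgPt M (α * g 1)) :
    InSpan (Finsupp.single (⟨curve M, smooth M h₂' h₃', theta0 M, hasAlgCoeffs_theta0 M h₂' h₃',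
        liftPath M (fun t => α * g t) hg' hαg h0' h1'⟩ : PeriodSymbol) (1 : ℂ) -
      α • Finsupp.single (⟨curve L, smooth L h₂ h₃, theta0 L, hasAlgCoeffs_theta0 L h₂ h₃,
        liftPath L g hg hΛ h0 h1⟩ : PeriodSymbol) 1) := by
  have hE := smooth L h₂ h₃
  have hEM := smooth M h₂' h₃'
  have hEC := smoothC_of (hR.isAlgPt_reps h₂ h₃) h₂ h₃
  have hθ := hasAlgCoeffs_theta0 L h₂ h₃
  have hθM := hasAlgCoeffs_theta0 M h₂' h₃'
  have hιθ : ∀ i, HasAlgCoeffs (formPullback iota (theta0 L) i) :=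
    HasAlgCoeffs.formPullback hasAlgCoeffs_iota hθ
  have hcθ : ∀ i, HasAlgCoeffs (formPullback (cmul L α S) (theta0 M) i) :=
    HasAlgCoeffs.formPullback (hasAlgCoeffs_cmul_of (hR.isAlgPt_reps h₂ h₃) hR.algebraic h₂ h₃) hθM
  have hαιθ : ∀ i, HasAlgCoeffs ((α • formPullback iota (theta0 L)) i) := fun i =>
    (hιθ i).smul hR.algebraic
  have hν : ∀ i, HasAlgCoeffs (nuC0 L M α S i) := fun i => (hcθ i).sub (hαιθ i)
  set Γ := hR.liftPathC h₂ h₃ g hg hαg h0 h1 with hΓ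
  have rι := IsElementaryRelation.pushforward (curveC L S) (curve L) hEC hE iota hasAlgCoeffs_iota
    iota_mapsTo_C (theta0 L) hθ (formPullback iota (theta0 L)) hιθ rfl
    Γ (liftPath L g hg hΛ h0 h1) (fun t _ => by
      rw [iota_eval, liftPath_toFun, hΓ, Reps.liftPathC_toFun]
      rfl)
  have rc := IsElementaryRelation.pushforward (curveC L S) (curve M) hEC hEM (cmul L α S)
    (hasAlgCoeffs_cmul_of (hR.isAlgPt_reps h₂ h₃) hR.algebraic h₂ h₃) hR.cmul_mapsTo (theta0 M) hθM
    (formPullback (cmul L α S) (theta0 M)) hcθ rfl Γ (liftPath M (fun t => α * g t) hg' hαg h0' h1')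
    (fun t ht => by rw [liftPath_toFun, hΓ, Reps.liftPathC_toFun, hR.cmul_psiC (hαg t ht)])
  have radd := IsElementaryRelation.add (curveC L S) hEC Γ
    (formPullback (cmul L α S) (theta0 M)) (nuC0 L M α S) (α • formPullback iota (theta0 L)) hcθ hν
    hαιθ (by rw [nuC0, sub_add_cancel])
  have rsmul := IsElementaryRelation.smul (curveC L S) hEC Γ α hR.algebraic
    (formPullback iota (theta0 L)) (α • formPullback iota (theta0 L)) hιθ hαιθ rfl
  have rvan := IsElementaryRelation.vanish (curveC L S) hEC Γ (nuC0 L M α S) hν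
    (hR.vanishesOn_nuC0 hEC)
  obtain ⟨k, ρ, cf, hρ, hcf, hsum⟩ :=
    span_add (span_add (span_add (span_sub (span_smul hR.algebraic (span_of_rel rι))
      (span_of_rel rc)) (span_of_rel radd)) (span_of_rel rsmul)) (span_of_rel rvan)
  refine ⟨k, ρ, cf, hρ, hcf, ?_⟩
  rw [← hsum, smul_sub]
  abel

/-- **The isogeny relation for `θ₁ = x dx/y`, up to an algebraic constant.** With the notation of
`span_cmul_theta0`,
`(E_M, θ₁, φ_M∘(αg)) − (|S|/α) (E_L, θ₁, φ_L∘g) + (K/α) (E_L, θ₀, φ_L∘g) + (G(ψ(g 1)) − G(ψ(g 0))) · 𝟙`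
lies in the span, where `K = Σ_{c ≠ 0} ℘(c)` and
`G(ψ(z)) = (2/α) Σ_{c ≠ 0} (ζ(z − c) − ζ(z) + ζ(c)) ∈ ℚ̄` at algebraic `z`
(`[α]^*θ₁ = (|S|/α) ι^*θ₁ − (K/α) ι^*θ₀ − dG` in `Ω¹(C_α)`; (R3) for `dG`). This is the relation
between the quasi-periods of isogenous curves.
[cite: HuberWustholz2022, Thm. 13.3 (2) (p. 121), §13.1 (B) (p. 120), §18.1 (p. 160)] [cite: Masser1975, Ch. III Lemma 3.1] -/
theorem Reps.span_cmul_theta1 {g : ℝ → ℂ} (hg : ContDiff ℝ 1 g)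
    (hαg : ∀ t ∈ Icc (0 : ℝ) 1, α * g t ∉ M.lattice)
    (hΛ : ∀ t ∈ Icc (0 : ℝ) 1, g t ∉ L.lattice)
    (h0 : IsAlgPt L (g 0)) (h1 : IsAlgPt L (g 1))
    (hg' : ContDiff ℝ 1 fun t => α * g t)
    (h0' : IsAlgPt M (α * g 0)) (h1' : IsAlgPt M (α * g 1)) :
    InSpan (Finsupp.single (⟨curve M, smooth M h₂' h₃', theta1 M, hasAlgCoeffs_theta1 M h₂' h₃',
        liftPath M (fun t => α * g t) hg' hαg h0' h1'⟩ : PeriodSymbol) (1 : ℂ) -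
      bC α S • Finsupp.single (⟨curve L, smooth L h₂ h₃, theta1 L, hasAlgCoeffs_theta1 L h₂ h₃,
        liftPath L g hg hΛ h0 h1⟩ : PeriodSymbol) 1 -
      aC L α S • Finsupp.single (⟨curve L, smooth L h₂ h₃, theta0 L, hasAlgCoeffs_theta0 L h₂ h₃,
        liftPath L g hg hΛ h0 h1⟩ : PeriodSymbol) 1 +
      (eval (psiC L S (g 1)) (GC L α S) - eval (psiC L S (g 0)) (GC L α S)) •
        Finsupp.single PeriodSymbol.unit (1 : ℂ)) := by
  have hE := smooth L h₂ h₃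
  have hEM := smooth M h₂' h₃'
  have hEC := smoothC_of (hR.isAlgPt_reps h₂ h₃) h₂ h₃
  have hθ1 := hasAlgCoeffs_theta1 L h₂ h₃
  have hθ1M := hasAlgCoeffs_theta1 M h₂' h₃'
  have hθ0 := hasAlgCoeffs_theta0 L h₂ h₃
  have hb := isAlgebraic_bC_of (S := S) hR.algebraic
  have ha := isAlgebraic_aC_of (hR.isAlgPt_reps h₂ h₃) hR.algebraic
  have hG := hasAlgCoeffs_GC_of (hR.isAlgPt_reps h₂ h₃) hR.algebraic
  have hιθ1 : ∀ i, HasAlgCoeffs (formPullback iota (theta1 L) i) :=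
    HasAlgCoeffs.formPullback hasAlgCoeffs_iota hθ1
  have hιθ0 : ∀ i, HasAlgCoeffs (formPullback iota (theta0 L) i) :=
    HasAlgCoeffs.formPullback hasAlgCoeffs_iota hθ0
  have hcθ : ∀ i, HasAlgCoeffs (formPullback (cmul L α S) (theta1 M) i) :=
    HasAlgCoeffs.formPullback (hasAlgCoeffs_cmul_of (hR.isAlgPt_reps h₂ h₃) hR.algebraic h₂ h₃) hθ1M
  have hdG : ∀ i, HasAlgCoeffs (formD (GC L α S) i) := hG.formD
  have hbι : ∀ i, HasAlgCoeffs ((bC α S • formPullback iota (theta1 L)) i) := fun i =>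
    (hιθ1 i).smul hb
  have haι : ∀ i, HasAlgCoeffs ((aC L α S • formPullback iota (theta0 L)) i) := fun i =>
    (hιθ0 i).smul ha
  set W : Fin 3 → MvPolynomial (Fin 3) ℂ :=
    bC α S • formPullback iota (theta1 L) + aC L α S • formPullback iota (theta0 L) with hW
  set U : Fin 3 → MvPolynomial (Fin 3) ℂ :=
    formPullback (cmul L α S) (theta1 M) + formD (GC L α S) with hU
  have hWa : ∀ i, HasAlgCoeffs (W i) := fun i => (hbι i).add (haι i)
  have hUa : ∀ i, HasAlgCoeffs (U i) := fun i => (hcθ i).add (hdG i)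
  have hν : ∀ i, HasAlgCoeffs (nuC1 L M α S i) := fun i =>
    (((hcθ i).sub (hbι i)).sub (haι i)).add (hdG i)
  have hdec : U = nuC1 L M α S + W := by
    rw [hU, hW, nuC1]
    abel
  set Γ := hR.liftPathC h₂ h₃ g hg hαg h0 h1 with hΓ
  have rι1 := IsElementaryRelation.pushforward (curveC L S) (curve L) hEC hE iota hasAlgCoeffs_iota
    iota_mapsTo_C (theta1 L) hθ1 (formPullback iota (theta1 L)) hιθ1 rfl
    Γ (liftPath L g hg hΛ h0 h1) (fun t _ => by
      rw [iota_eval, liftPath_toFun, hΓ, Reps.liftPathC_toFun]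
      rfl)
  have rι0 := IsElementaryRelation.pushforward (curveC L S) (curve L) hEC hE iota hasAlgCoeffs_iota
    iota_mapsTo_C (theta0 L) hθ0 (formPullback iota (theta0 L)) hιθ0 rfl
    Γ (liftPath L g hg hΛ h0 h1) (fun t _ => by
      rw [iota_eval, liftPath_toFun, hΓ, Reps.liftPathC_toFun]
      rfl)
  have rc := IsElementaryRelation.pushforward (curveC L S) (curve M) hEC hEM (cmul L α S)
    (hasAlgCoeffs_cmul_of (hR.isAlgPt_reps h₂ h₃) hR.algebraic h₂ h₃) hR.cmul_mapsTo (theta1 M) hθ1M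
    (formPullback (cmul L α S) (theta1 M)) hcθ rfl Γ (liftPath M (fun t => α * g t) hg' hαg h0' h1')
    (fun t ht => by rw [liftPath_toFun, hΓ, Reps.liftPathC_toFun, hR.cmul_psiC (hαg t ht)])
  have raddU := IsElementaryRelation.add (curveC L S) hEC Γ U
    (formPullback (cmul L α S) (theta1 M)) (formD (GC L α S)) hUa hcθ hdG rfl
  have radd₁ := IsElementaryRelation.add (curveC L S) hEC Γ U (nuC1 L M α S) W hUa hν hWa hdec
  have radd₂ := IsElementaryRelation.add (curveC L S) hEC Γ W
    (bC α S • formPullback iota (theta1 L)) (aC L α S • formPullback iota (theta0 L)) hWa hbι haι rfl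
  have rsmul₁ := IsElementaryRelation.smul (curveC L S) hEC Γ (bC α S) hb
    (formPullback iota (theta1 L)) (bC α S • formPullback iota (theta1 L)) hιθ1 hbι rfl
  have rsmul₂ := IsElementaryRelation.smul (curveC L S) hEC Γ (aC L α S) ha
    (formPullback iota (theta0 L)) (aC L α S • formPullback iota (theta0 L)) hιθ0 haι rfl
  have rvan := IsElementaryRelation.vanish (curveC L S) hEC Γ (nuC1 L M α S) hν
    (hR.vanishesOn_nuC1 hEC)
  have rex := IsElementaryRelation.exact (curveC L S) hEC Γ (GC L α S) hG
    (formD (GC L α S)) hdG rfl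
  have e1 : Γ.toFun 1 = psiC L S (g 1) := by rw [hΓ]; rfl
  have e0 : Γ.toFun 0 = psiC L S (g 0) := by rw [hΓ]; rfl
  rw [e1, e0] at rex
  obtain ⟨k, ρ, cf, hρ, hcf, hsum⟩ :=
    span_sub (span_sub (span_sub (span_add (span_add (span_add (span_add (span_add (span_add
      (span_of_rel radd₁) (span_of_rel rvan)) (span_of_rel radd₂)) (span_of_rel rsmul₁))
      (span_smul hb (span_of_rel rι1))) (span_of_rel rsmul₂)) (span_smul ha (span_of_rel rι0)))
      (span_of_rel rex)) (span_of_rel raddU)) (span_of_rel rc)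
  refine ⟨k, ρ, cf, hρ, hcf, ?_⟩
  rw [← hsum, smul_sub, smul_sub]
  abel

end Relations

end Isog

end Ell

end CurvePeriods

end Literature.NumberTheory.Transcendental

end
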